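import Literature.NumberTheory.Automorphic.SiegelReducedFamiliesQuadForm
import HarnessLib

/-!
# Siegel-reduced families: the Schur complement of a weighted sum

Topic `NumberTheory/Automorphic`; namespace `Literature.NumberTheory.Automorphic`, grouping
sub-namespace `SiegelFamily`.  Second of three files proving the Hull Lemma (theorems only).

* `schur_eq_topLeft_sub`, `qf_schur` — the Schur complement family `SiegelFamily.schur` of a
  Hermitian family as the matrix `H♭ − H[m,m]⁻¹ v vᴴ` and its quadratic form
  `qf H♭ z − ‖vᴴ z‖² / H[m,m]`;
* `norm_sum_sq_le_of_sq_le` — weighted Cauchy–Schwarz `‖Σ γ_k‖² ≤ (Σ p_k)(Σ q_k)` from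
  `‖γ_k‖² ≤ p_k q_k`;
* bookkeeping for weighted sums `Σ wtᵢ • Gᵢ + E` (entries, Hermitian-ness, `qf`, pairings);
* `qf_schur_sum_sub_bounds` — **the core estimate** (quantitative concavity of the Schur
  complement): for Hermitian `Gᵢ` with corners `aᵢ > 0` and columns `< c aᵢ`, weights `wtᵢ ≥ 0`
  with `A = Σ wtᵢ aᵢ > 0`, and `0 ≤ E ≤ η A · 1`,
  `0 ≤ qf (schur (Σ wtᵢ Gᵢ + E)) z − Σ wtᵢ qf (schur Gᵢ) z ≤ (η + m c²) A Σ ‖z j‖²`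
  (lower bound: weighted Cauchy–Schwarz with `‖(lastCol E)ᴴ z‖² ≤ e · qf E♭ z`; upper bound:
  drop the negative term and bound the columns).

## References

* R. A. Horn, C. R. Johnson, *Matrix Analysis*, 2nd ed. (2013), §7.7 (the Schur complement is
  matrix-concave) — standard material. [folklore]
* A. Borel, *Introduction aux groupes arithmétiques*, Hermann (1969), §1, §12–§13 [Borel1969].
-/

noncomputable section

open scoped ComplexOrder Matrix ComplexConjugate
open Finset

namespace Literature.NumberTheory.Automorphic

namespace SiegelFamily

/-! ### Weighted Cauchy–Schwarz and the Schur complement as a matrix -/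

section SchurTools

variable {m : ℕ}

/-- **Weighted Cauchy–Schwarz**: if `‖γ_k‖² ≤ p_k q_k` with `p_k, q_k ≥ 0` then
`‖Σ γ_k‖² ≤ (Σ p_k)(Σ q_k)`. [folklore] -/
theorem norm_sum_sq_le_of_sq_le {σ : Type*} (s : Finset σ) (γ : σ → ℂ) (p q : σ → ℝ)
    (hp : ∀ k ∈ s, 0 ≤ p k) (hq : ∀ k ∈ s, 0 ≤ q k) (h : ∀ k ∈ s, ‖γ k‖ ^ 2 ≤ p k * q k) :
    ‖∑ k ∈ s, γ k‖ ^ 2 ≤ (∑ k ∈ s, p k) * ∑ k ∈ s, q k := by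
  have h1 : ‖∑ k ∈ s, γ k‖ ≤ ∑ k ∈ s, Real.sqrt (p k) * Real.sqrt (q k) := by
    refine (norm_sum_le _ _).trans (Finset.sum_le_sum fun k hk => ?_)
    rw [← Real.sqrt_mul (hp k hk), ← Real.sqrt_sq (norm_nonneg (γ k))]
    exact Real.sqrt_le_sqrt (h k hk)
  have h2 : (∑ k ∈ s, Real.sqrt (p k) * Real.sqrt (q k)) ^ 2 ≤
      (∑ k ∈ s, Real.sqrt (p k) ^ 2) * ∑ k ∈ s, Real.sqrt (q k) ^ 2 :=
    sum_mul_sq_le_sq_mul_sq _ _ _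
  have h3 : ∑ k ∈ s, Real.sqrt (p k) ^ 2 = ∑ k ∈ s, p k :=
    Finset.sum_congr rfl fun k hk => Real.sq_sqrt (hp k hk)
  have h4 : ∑ k ∈ s, Real.sqrt (q k) ^ 2 = ∑ k ∈ s, q k :=
    Finset.sum_congr rfl fun k hk => Real.sq_sqrt (hq k hk)
  have h0 : 0 ≤ ∑ k ∈ s, Real.sqrt (p k) * Real.sqrt (q k) :=
    Finset.sum_nonneg fun k _ => mul_nonneg (Real.sqrt_nonneg _) (Real.sqrt_nonneg _)
  calc ‖∑ k ∈ s, γ k‖ ^ 2 ≤ (∑ k ∈ s, Real.sqrt (p k) * Real.sqrt (q k)) ^ 2 :=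
        pow_le_pow_left₀ (norm_nonneg _) h1 2
    _ ≤ (∑ k ∈ s, Real.sqrt (p k) ^ 2) * ∑ k ∈ s, Real.sqrt (q k) ^ 2 := h2
    _ = (∑ k ∈ s, p k) * ∑ k ∈ s, q k := by rw [h3, h4]

/-- The rank-one matrix `u uᴴ` is Hermitian. [folklore] -/
theorem isHermitian_vecMulVec_star {n : Type*} (u : n → ℂ) :
    (Matrix.vecMulVec u (star u)).IsHermitian := by
  refine Matrix.IsHermitian.ext fun i j => ?_
  simp [Matrix.vecMulVec_apply, mul_comm]

/-- Diagonal entries of a Hermitian complex matrix are real. [folklore] -/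
theorem apply_self_eq_ofReal_re {n : Type*} {M : Matrix n n ℂ} (hM : M.IsHermitian) (i : n) :
    M i i = ((M i i).re : ℂ) := by
  have h : conj (M i i) = M i i := by simpa using hM.apply i i
  exact (Complex.conj_eq_iff_re.1 h).symm

/-- **The Schur complement family as a matrix**: for `H_w` Hermitian,
`schur H w = H_w♭ − H_w[m,m]⁻¹ · v vᴴ` with `v = lastCol H_w`. [folklore] -/
theorem schur_eq_topLeft_sub {ι : Type*} {H : ι → Matrix (Fin (m + 1)) (Fin (m + 1)) ℂ} (w : ι)
    (hH : (H w).IsHermitian) :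
    schur H w = topLeft (H w) -
      (H w (Fin.last m) (Fin.last m))⁻¹ • Matrix.vecMulVec (lastCol (H w)) (star (lastCol (H w))) := by
  ext i j
  have hr : H w (Fin.last m) j.castSucc = conj (H w j.castSucc (Fin.last m)) :=
    (hH.apply (Fin.last m) j.castSucc).symm
  simp only [schur_apply, Matrix.sub_apply, Matrix.smul_apply, Matrix.vecMulVec_apply,
    Matrix.submatrix_apply, Pi.star_apply, Complex.star_def, smul_eq_mul, hr]
  ring

/-- The Schur complement of a Hermitian matrix (of a family) is Hermitian. [folklore] -/
theorem isHermitian_schur {ι : Type*} {H : ι → Matrix (Fin (m + 1)) (Fin (m + 1)) ℂ} (w : ι)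
    (hH : (H w).IsHermitian) : (schur H w).IsHermitian := by
  rw [schur_eq_topLeft_sub w hH]
  refine (hH.submatrix Fin.castSucc).sub ?_
  refine (isHermitian_vecMulVec_star _).smul ?_
  -- the corner is real, so its inverse is self-adjoint
  rw [apply_self_eq_ofReal_re hH (Fin.last m), ← Complex.ofReal_inv]
  unfold IsSelfAdjoint
  exact Complex.conj_ofReal _

/-- `qf` of a complex multiple of a Hermitian matrix. [folklore] -/
theorem qf_smul_complex {n : Type*} [Fintype n] (c : ℂ) {N : Matrix n n ℂ} (hN : N.IsHermitian)
    (y : n → ℂ) : qf (c • N) y = c.re * qf N y := by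
  rw [qf, Matrix.smul_mulVec, dotProduct_smul, smul_eq_mul, star_dotProduct_mulVec_eq_qf hN,
    Complex.re_mul_ofReal]

/-- **`qf` of the Schur complement**: `qf (schur H w) z = qf H_w♭ z − ‖vᴴ z‖² / H_w[m,m]`.
[folklore] -/
theorem qf_schur {ι : Type*} {H : ι → Matrix (Fin (m + 1)) (Fin (m + 1)) ℂ} (w : ι)
    (hH : (H w).IsHermitian) (z : Fin m → ℂ) :
    qf (schur H w) z = qf (topLeft (H w)) z -
      ‖star (lastCol (H w)) ⬝ᵥ z‖ ^ 2 / (H w (Fin.last m) (Fin.last m)).re := by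
  rw [schur_eq_topLeft_sub w hH, qf_sub, qf_smul_complex _ (isHermitian_vecMulVec_star _),
    qf_vecMulVec_star]
  rw [apply_self_eq_ofReal_re hH (Fin.last m), ← Complex.ofReal_inv, Complex.ofReal_re,
    Complex.ofReal_re, div_eq_inv_mul]

/-- A `0 × 0` matrix is positive semidefinite. [folklore] -/
theorem posSemidef_fin_zero (M : Matrix (Fin 0) (Fin 0) ℂ) : M.PosSemidef := by
  refine Matrix.PosSemidef.of_dotProduct_mulVec_nonneg (Matrix.IsHermitian.ext fun i => Fin.elim0 i)
    fun x => ?_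
  simp [dotProduct]

end SchurTools

/-! ### Linear-algebra bookkeeping for weighted sums of families -/

section Sums

variable {n : Type*} {σ : Type*}

/-- Entries of `Σ wtᵢ • Gᵢ + E`. [folklore] -/
theorem sum_smul_add_apply (s : Finset σ) (wt : σ → ℝ) (G : σ → Matrix n n ℂ) (E : Matrix n n ℂ)
    (a b : n) : (∑ i ∈ s, wt i • G i + E) a b = ∑ i ∈ s, (wt i : ℂ) * G i a b + E a b := by
  simp [Matrix.sum_apply, Complex.real_smul]

/-- Real parts of the entries of `Σ wtᵢ • Gᵢ + E`. [folklore] -/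
theorem re_sum_smul_add_apply (s : Finset σ) (wt : σ → ℝ) (G : σ → Matrix n n ℂ)
    (E : Matrix n n ℂ) (a b : n) :
    ((∑ i ∈ s, wt i • G i + E) a b).re = ∑ i ∈ s, wt i * (G i a b).re + (E a b).re := by
  rw [sum_smul_add_apply, Complex.add_re, Complex.re_sum]
  simp

/-- `Σ wtᵢ • Gᵢ + E` is Hermitian when the `Gᵢ` and `E` are (real weights). [folklore] -/
theorem isHermitian_sum_smul_add (s : Finset σ) (wt : σ → ℝ) (G : σ → Matrix n n ℂ)
    (E : Matrix n n ℂ) (hG : ∀ i ∈ s, (G i).IsHermitian) (hE : E.IsHermitian) :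
    (∑ i ∈ s, wt i • G i + E).IsHermitian := by
  refine Matrix.IsHermitian.add ?_ hE
  classical
  induction s using Finset.induction_on with
  | empty => simp
  | insert a s ha ih =>
    rw [Finset.sum_insert ha]
    refine Matrix.IsHermitian.add ?_ (ih fun i hi => hG i (Finset.mem_insert_of_mem hi))
    exact (hG a (Finset.mem_insert_self a s)).smul (IsSelfAdjoint.all (wt a))

variable [Fintype n]

/-- `qf` of `Σ wtᵢ • Gᵢ + E`. [folklore] -/
theorem qf_sum_smul_add (s : Finset σ) (wt : σ → ℝ) (G : σ → Matrix n n ℂ) (E : Matrix n n ℂ)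
    (y : n → ℂ) : qf (∑ i ∈ s, wt i • G i + E) y = ∑ i ∈ s, wt i * qf (G i) y + qf E y := by
  rw [qf_add, qf_sum]
  simp [qf_smul]

/-- `uᴴ z` is conjugate-linear in `u`: the pairing with `Σ wtᵢ • uᵢ + v`. [folklore] -/
theorem star_sum_smul_add_dotProduct (s : Finset σ) (wt : σ → ℝ) (u : σ → n → ℂ) (v z : n → ℂ) :
    star (∑ i ∈ s, wt i • u i + v) ⬝ᵥ z = ∑ i ∈ s, (wt i : ℂ) * (star (u i) ⬝ᵥ z) + star v ⬝ᵥ z := by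
  rw [star_add, add_dotProduct, star_sum, sum_dotProduct]
  refine congrArg (· + _) (Finset.sum_congr rfl fun i _ => ?_)
  rw [star_smul, star_trivial, smul_dotProduct, Complex.real_smul]

end Sums

/-! ### The core estimate for the Schur complement of a weighted sum -/

section Core

variable {ι σ : Type*} {m : ℕ}

/-- **Concavity of the Schur complement, quantitatively.**  For Hermitian `Gᵢ` with positive
corners `aᵢ` and columns bounded by `c aᵢ`, non-negative weights, and `E ≥ 0` with
`E ≤ η A · 1` (`A = Σ wtᵢ aᵢ > 0`), the difference
`D = qf (schur (Σ wtᵢ Gᵢ + E)) z − Σ wtᵢ qf (schur Gᵢ) z` satisfies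
`0 ≤ D ≤ (η + m c²) A Σ ‖z j‖²`. [folklore] -/
theorem qf_schur_sum_sub_bounds (s : Finset σ) (wt : σ → ℝ)
    (G : σ → ι → Matrix (Fin (m + 1)) (Fin (m + 1)) ℂ) (E : ι → Matrix (Fin (m + 1)) (Fin (m + 1)) ℂ)
    {c η : ℝ} (hwt : ∀ i ∈ s, 0 ≤ wt i)
    (hGh : ∀ i ∈ s, ∀ w, (G i w).IsHermitian)
    (hGpos : ∀ i ∈ s, ∀ w, 0 < (G i w (Fin.last m) (Fin.last m)).re)
    (hGcol : ∀ i ∈ s, ∀ w (j : Fin m),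
      ‖G i w j.castSucc (Fin.last m)‖ < c * (G i w (Fin.last m) (Fin.last m)).re)
    (hE : ∀ w, (E w).PosSemidef)
    (hEb : ∀ w, ((η * ∑ i ∈ s, wt i * (G i w (Fin.last m) (Fin.last m)).re) •
      (1 : Matrix (Fin (m + 1)) (Fin (m + 1)) ℂ) - E w).PosSemidef)
    (hA : ∀ w, 0 < ∑ i ∈ s, wt i * (G i w (Fin.last m) (Fin.last m)).re) (w : ι) (z : Fin m → ℂ) :
    0 ≤ qf (schur (fun w => ∑ i ∈ s, wt i • G i w + E w) w) z -
        ∑ i ∈ s, wt i * qf (schur (G i) w) z ∧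
      qf (schur (fun w => ∑ i ∈ s, wt i • G i w + E w) w) z -
          ∑ i ∈ s, wt i * qf (schur (G i) w) z ≤
        (η + m * c ^ 2) * (∑ i ∈ s, wt i * (G i w (Fin.last m) (Fin.last m)).re) * ∑ j, ‖z j‖ ^ 2 := by
  classical
  -- notation
  set H : ι → Matrix (Fin (m + 1)) (Fin (m + 1)) ℂ := fun w => ∑ i ∈ s, wt i • G i w + E w with hHdef
  set a : σ → ℝ := fun i => (G i w (Fin.last m) (Fin.last m)).re with hadef
  set A : ℝ := ∑ i ∈ s, wt i * (G i w (Fin.last m) (Fin.last m)).re with hAdef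
  set e : ℝ := (E w (Fin.last m) (Fin.last m)).re with hedef
  set Z : ℝ := ∑ j, ‖z j‖ ^ 2 with hZdef
  set βG : σ → ℂ := fun i => star (lastCol (G i w)) ⬝ᵥ z with hβGdef
  set βE : ℂ := star (lastCol (E w)) ⬝ᵥ z with hβEdef
  set q : ℝ := qf (topLeft (E w)) z with hqdef
  have hZ0 : 0 ≤ Z := Finset.sum_nonneg fun j _ => sq_nonneg _
  have hAw : 0 < A := hA w
  have hHh : (H w).IsHermitian :=
    isHermitian_sum_smul_add s wt (fun i => G i w) (E w) (fun i hi => hGh i hi w) (hE w).1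
  obtain ⟨he0, heA⟩ := corner_re_le (hE w) (hEb w)
  have hAe : 0 < A + e := by rw [hAdef]; linarith
  -- block data of `H w`
  have hcolH : lastCol (H w) = ∑ i ∈ s, wt i • lastCol (G i w) + lastCol (E w) := by
    funext j
    simp [hHdef, lastCol, Matrix.sum_apply]
  have hβH : star (lastCol (H w)) ⬝ᵥ z = ∑ i ∈ s, (wt i : ℂ) * βG i + βE := by
    rw [hcolH, star_sum_smul_add_dotProduct]
  have htlH : topLeft (H w) = ∑ i ∈ s, wt i • topLeft (G i w) + topLeft (E w) := by
    ext x y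
    simp [hHdef, topLeft, Matrix.sum_apply]
  have hcornerH : (H w (Fin.last m) (Fin.last m)).re = A + e := by
    rw [hHdef]
    exact re_sum_smul_add_apply s wt (fun i => G i w) (E w) (Fin.last m) (Fin.last m)
  -- the difference `D`
  have hD : qf (schur H w) z - ∑ i ∈ s, wt i * qf (schur (G i) w) z =
      q + ∑ i ∈ s, wt i * (‖βG i‖ ^ 2 / a i) -
        ‖∑ i ∈ s, (wt i : ℂ) * βG i + βE‖ ^ 2 / (A + e) := by
    have h1 : qf (schur H w) z = (∑ i ∈ s, wt i * qf (topLeft (G i w)) z + q) -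
        ‖∑ i ∈ s, (wt i : ℂ) * βG i + βE‖ ^ 2 / (A + e) := by
      rw [qf_schur w hHh, htlH, qf_sum_smul_add, hβH, hcornerH]
    have h2 : ∑ i ∈ s, wt i * qf (schur (G i) w) z =
        ∑ i ∈ s, wt i * qf (topLeft (G i w)) z - ∑ i ∈ s, wt i * (‖βG i‖ ^ 2 / a i) := by
      rw [← Finset.sum_sub_distrib]
      refine Finset.sum_congr rfl fun i hi => ?_
      rw [qf_schur w (hGh i hi w) z, mul_sub]
    rw [h1, h2]
    ring
  -- weighted Cauchy–Schwarz over `insertNone s`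
  have hCS : ‖∑ i ∈ s, (wt i : ℂ) * βG i + βE‖ ^ 2 ≤
      (A + e) * (∑ i ∈ s, wt i * (‖βG i‖ ^ 2 / a i) + q) := by
    have h := norm_sum_sq_le_of_sq_le (Finset.insertNone s)
      (fun o => o.elim βE (fun i => (wt i : ℂ) * βG i))
      (fun o => o.elim e (fun i => wt i * a i))
      (fun o => o.elim q (fun i => wt i * (‖βG i‖ ^ 2 / a i))) ?_ ?_ ?_
    · simp only [Finset.sum_insertNone, Option.elim] at h
      calc ‖∑ i ∈ s, (wt i : ℂ) * βG i + βE‖ ^ 2 = ‖βE + ∑ i ∈ s, (wt i : ℂ) * βG i‖ ^ 2 := by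
            rw [add_comm]
        _ ≤ (e + ∑ i ∈ s, wt i * a i) * (q + ∑ i ∈ s, wt i * (‖βG i‖ ^ 2 / a i)) := h
        _ = (A + e) * (∑ i ∈ s, wt i * (‖βG i‖ ^ 2 / a i) + q) := by rw [hAdef]; ring
    · rintro (_ | i) hi
      · exact he0
      · have hi' := Finset.some_mem_insertNone.1 hi
        exact mul_nonneg (hwt i hi') (hGpos i hi' w).le
    · rintro (_ | i) hi
      · exact qf_nonneg_of_posSemidef ((hE w).submatrix Fin.castSucc) z
      · have hi' := Finset.some_mem_insertNone.1 hi
        exact mul_nonneg (hwt i hi') (div_nonneg (sq_nonneg _) (hGpos i hi' w).le)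
    · rintro (_ | i) hi
      · exact norm_sq_le_corner_mul_qf_topLeft (hE w) z
      · have hi' := Finset.some_mem_insertNone.1 hi
        have ha0 : a i ≠ 0 := (hGpos i hi' w).ne'
        simp only [Option.elim]
        rw [norm_mul, Complex.norm_real, Real.norm_of_nonneg (hwt i hi'), mul_pow]
        field_simp
        exact le_of_eq (by ring)
  constructor
  · -- lower bound: `0 ≤ D`
    rw [hD]
    have h := (div_le_iff₀ hAe).2 (hCS.trans_eq (mul_comm _ _))
    linarith
  · -- upper bound
    rw [hD]
    have hdiv0 : 0 ≤ ‖∑ i ∈ s, (wt i : ℂ) * βG i + βE‖ ^ 2 / (A + e) :=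
      div_nonneg (sq_nonneg _) hAe.le
    have hq : q ≤ η * A * Z := qf_topLeft_le (hE w).1 (hEb w) z
    have hβi : ∀ i ∈ s, ‖βG i‖ ^ 2 / a i ≤ m * c ^ 2 * a i * Z := by
      intro i hi
      have hcs := norm_star_dotProduct_sq_le (lastCol (G i w)) z
      have hcol2 : ∑ j, ‖lastCol (G i w) j‖ ^ 2 ≤ m * (c * a i) ^ 2 := by
        calc ∑ j, ‖lastCol (G i w) j‖ ^ 2 ≤ ∑ _j : Fin m, (c * a i) ^ 2 :=
              Finset.sum_le_sum fun j _ =>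
                pow_le_pow_left₀ (norm_nonneg _) (hGcol i hi w j).le 2
          _ = m * (c * a i) ^ 2 := by simp
      rw [div_le_iff₀ (hGpos i hi w)]
      calc ‖βG i‖ ^ 2 ≤ (∑ j, ‖lastCol (G i w) j‖ ^ 2) * Z := hcs
        _ ≤ (m * (c * a i) ^ 2) * Z := mul_le_mul_of_nonneg_right hcol2 hZ0
        _ = m * c ^ 2 * a i * Z * (G i w (Fin.last m) (Fin.last m)).re := by rw [hadef]; ring
    have hsum : ∑ i ∈ s, wt i * (‖βG i‖ ^ 2 / a i) ≤ ∑ i ∈ s, wt i * (m * c ^ 2 * a i * Z) :=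
      Finset.sum_le_sum fun i hi => mul_le_mul_of_nonneg_left (hβi i hi) (hwt i hi)
    have heq : ∑ i ∈ s, wt i * (m * c ^ 2 * a i * Z) = m * c ^ 2 * A * Z := by
      rw [hAdef, Finset.mul_sum s _ (↑m * c ^ 2), Finset.sum_mul s _ Z]
      exact Finset.sum_congr rfl fun i _ => by ring
    nlinarith [hsum, heq, hq, hdiv0]

end Core

end SiegelFamily

end Literature.NumberTheory.Automorphic
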